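/-
Copyright (c) 2026. All rights reserved.
Released under Apache 2.0 license as described in the file LICENSE.
Authors: abc-iut cell, wave-2 seat abc-iut-L3-t11 (proof-only; row «(I4) PRODUCER REDUCTION», piece 3a: a uniform
conjugator by compactness — the "converge in the profinite topology" step of Comments (6)(b)).
-/
import Mathlib.Topology.Algebra.OpenSubgroup
import Mathlib.Algebra.Group.Subgroup.Finite
import Mathlib.GroupTheory.QuotientGroup.Basic
import HarnessLib

/-!
# A uniform conjugator in a compact group (the compactness step of [SemiAnbd] Thm 3.7 (iii), Comments (6)(b))

Mochizuki, *Semi-graphs of anabelioids*, Publ. RIMS **42** (2006) [MochizukiSemiAnbd2006], proof of Thm 3.7 (iii)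
with the author's *Comments* (2020), (6)(b): "for some cofinal subset `J* ⊆ J`, the subjoints … converge, in the
profinite topology, to some profinite subjoint … this implies [cf. Remark 2.2.1] that `H` is contained in some
conjugate in the profinite fundamental group `π̂₁(G)` of some `π̂₁(G_v)`". The group-theoretic mechanism: at each
finite level `i` the stabiliser `S_i` of the level-`i` vertex is `γ_i·A·γ_i⁻¹·M_i` for a conjugate of the
decomposition group `A ≅ Π_v` and the level kernel `M_i` (open normal); the conjugators `γ_i` may be chosen
UNIFORMLY (one `γ` for all levels) because the sets of admissible conjugators are nonempty, clopen and decreasing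
in the compact group.

PROOF-ONLY, pure topological group theory (no anabelioids):
* `map_conj_sup_eq_of_mem`, `map_conj_mul_sup_eq` — conjugating by an element of a normal `M` does not change
  `A ⊔ M`;
* `map_conj_sup_eq_of_le` — in a group with FINITE quotient by the normal `M`, `γ₁Aγ₁⁻¹ ≤ γ₂Aγ₂⁻¹·M` forces
  `γ₁Aγ₁⁻¹·M = γ₂Aγ₂⁻¹·M` (equal finite cardinalities of conjugate images);
* `exists_uniform_conj` — compact `Q`, open normal `M_i` along a directed order, subgroups `S_i`
  antitone with each `S_i = γ_i·A·γ_i⁻¹ ⊔ M_i` for SOME `γ_i` ⇒ one `γ` with `S_i = γ·A·γ⁻¹ ⊔ M_i` for ALL `i`.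
-/

namespace Literature.AnabelianGeometry.SemiGraphs

open Topology
open scoped Pointwise

universe v u

variable {Q : Type u} [Group Q]

/-! ### Conjugating by elements of a normal subgroup -/

/-- `m·A·m⁻¹ ⊔ M = A ⊔ M` for `m ∈ M`, `M` normal. [cite: MochizukiSemiAnbd2006, Thm. 3.7(iii) p.41] -/
theorem map_conj_sup_eq_of_mem {A M : Subgroup Q} [M.Normal] {m : Q} (hm : m ∈ M) :
    A.map (MulAut.conj m).toMonoidHom ⊔ M = A ⊔ M := by
  apply le_antisymm
  · refine sup_le ?_ le_sup_right
    rintro _ ⟨a, ha, rfl⟩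
    simp only [MulEquiv.coe_toMonoidHom, MulAut.conj_apply]
    -- `m a m⁻¹ = a · (a⁻¹ m a m⁻¹)` with the second factor in `M`
    have h1 : m * a * m⁻¹ = a * (a⁻¹ * m * a * m⁻¹) := by
      simp only [← mul_assoc, mul_inv_cancel, one_mul]
    rw [h1]
    refine Subgroup.mul_mem _ (Subgroup.mem_sup_left ha) (Subgroup.mem_sup_right ?_)
    have h2 : a⁻¹ * m * a ∈ M := by
      have := ‹M.Normal›.conj_mem m hm a⁻¹
      simpa using this
    exact M.mul_mem h2 (M.inv_mem hm)
  · refine sup_le ?_ le_sup_right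
    intro a ha
    -- `a = (m a m⁻¹) · (m a⁻¹ m⁻¹ a)` with the second factor in `M`
    have h1 : a = (m * a * m⁻¹) * (m * a⁻¹ * m⁻¹ * a) := by
      simp only [← mul_assoc]
      simp [mul_assoc]
    rw [h1]
    refine Subgroup.mul_mem _ (Subgroup.mem_sup_left ⟨a, ha, rfl⟩) (Subgroup.mem_sup_right ?_)
    have h2 : a⁻¹ * m⁻¹ * a ∈ M := by
      have := ‹M.Normal›.conj_mem m⁻¹ (M.inv_mem hm) a⁻¹
      simpa using this
    have h3 : m * a⁻¹ * m⁻¹ * a = m * (a⁻¹ * m⁻¹ * a) := by simp only [mul_assoc]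
    rw [h3]
    exact M.mul_mem hm h2

/-- `(γm)·A·(γm)⁻¹ ⊔ M = γ·A·γ⁻¹ ⊔ M` for `m ∈ M`, `M` normal. [cite: MochizukiSemiAnbd2006, Thm. 3.7(iii) p.41] -/
theorem map_conj_mul_sup_eq {A M : Subgroup Q} [M.Normal] (γ : Q) {m : Q} (hm : m ∈ M) :
    A.map (MulAut.conj (γ * m)).toMonoidHom ⊔ M = A.map (MulAut.conj γ).toMonoidHom ⊔ M := by
  have hMγ : M.map (MulAut.conj γ).toMonoidHom = M := by
    ext x
    constructor
    · rintro ⟨y, hy, rfl⟩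
      exact ‹M.Normal›.conj_mem y hy γ
    · intro hx
      refine ⟨γ⁻¹ * x * γ, ?_, by simp [mul_assoc]⟩
      have := ‹M.Normal›.conj_mem x hx γ⁻¹
      simpa using this
  have hcomp : (MulAut.conj (γ * m)).toMonoidHom =
      (MulAut.conj γ).toMonoidHom.comp (MulAut.conj m).toMonoidHom := by
    ext x; simp [mul_assoc]
  calc A.map (MulAut.conj (γ * m)).toMonoidHom ⊔ M
      = (A.map (MulAut.conj m).toMonoidHom).map (MulAut.conj γ).toMonoidHom ⊔
          M.map (MulAut.conj γ).toMonoidHom := by rw [hcomp, ← Subgroup.map_map, hMγ]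
    _ = (A.map (MulAut.conj m).toMonoidHom ⊔ M).map (MulAut.conj γ).toMonoidHom := by
          rw [Subgroup.map_sup]
    _ = (A ⊔ M).map (MulAut.conj γ).toMonoidHom := by rw [map_conj_sup_eq_of_mem hm]
    _ = A.map (MulAut.conj γ).toMonoidHom ⊔ M := by rw [Subgroup.map_sup, hMγ]

/-! ### The cardinality step in a finite quotient -/

/-- **Conjugate images with finite quotient**: if `Q ⧸ M` is finite (`M` normal) and
`γ₁·A·γ₁⁻¹ ≤ γ₂·A·γ₂⁻¹ ⊔ M`, then `γ₁·A·γ₁⁻¹ ⊔ M = γ₂·A·γ₂⁻¹ ⊔ M` (the two images in `Q ⧸ M` are conjugate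
finite subgroups, one inside the other). [cite: MochizukiSemiAnbd2006, Thm. 3.7(iii) p.41] -/
theorem map_conj_sup_eq_of_le {A M : Subgroup Q} [M.Normal] [Finite (Q ⧸ M)] (γ₁ γ₂ : Q)
    (h : A.map (MulAut.conj γ₁).toMonoidHom ≤ A.map (MulAut.conj γ₂).toMonoidHom ⊔ M) :
    A.map (MulAut.conj γ₁).toMonoidHom ⊔ M = A.map (MulAut.conj γ₂).toMonoidHom ⊔ M := by
  set π : Q →* Q ⧸ M := QuotientGroup.mk' M with hπ
  have hker : π.ker = M := QuotientGroup.ker_mk' M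
  have hπM : M.map π = ⊥ := by
    rw [eq_bot_iff]; rintro _ ⟨m, hm, rfl⟩
    rw [Subgroup.mem_bot, ← MonoidHom.mem_ker, hker]; exact hm
  -- images in the finite quotient are conjugate
  have himg : ∀ γ : Q, (A.map (MulAut.conj γ).toMonoidHom).map π =
      (A.map π).map (MulAut.conj (π γ)).toMonoidHom := by
    intro γ
    have hc : π.comp (MulAut.conj γ).toMonoidHom = (MulAut.conj (π γ)).toMonoidHom.comp π := by
      ext x; simp
    rw [Subgroup.map_map, Subgroup.map_map, hc]
  have hcard : Nat.card ((A.map (MulAut.conj γ₁).toMonoidHom).map π) =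
      Nat.card ((A.map (MulAut.conj γ₂).toMonoidHom).map π) := by
    rw [himg γ₁, himg γ₂,
      Subgroup.card_map_of_injective (f := (MulAut.conj (π γ₁)).toMonoidHom) (MulAut.conj (π γ₁)).injective,
      Subgroup.card_map_of_injective (f := (MulAut.conj (π γ₂)).toMonoidHom) (MulAut.conj (π γ₂)).injective]
  have hle : (A.map (MulAut.conj γ₁).toMonoidHom).map π ≤ (A.map (MulAut.conj γ₂).toMonoidHom).map π := by
    refine (Subgroup.map_mono h).trans ?_
    rw [Subgroup.map_sup, hπM, sup_bot_eq]
  have heq := Subgroup.eq_of_le_of_card_ge hle hcard.symm.le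
  have h1 := congrArg (Subgroup.comap π) heq
  rw [Subgroup.comap_map_eq, Subgroup.comap_map_eq, hker] at h1
  exact h1

/-! ### The uniform conjugator -/

/-- **A uniform conjugator by compactness** ("converge in the profinite topology", Comments (6)(b)): in a compact
topological group `Q`, let `(M_i)` be open normal subgroups indexed by a directed order, and `(S_i)` an
antitone family of subgroups, each of the form `S_i = γ_i·A·γ_i⁻¹ ⊔ M_i` for SOME `γ_i`. Then there is ONE `γ`
with `S_i = γ·A·γ⁻¹ ⊔ M_i` for all `i`: the sets `C_i = {γ | S_i = γAγ⁻¹ ⊔ M_i}` are nonempty, right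
`M_i`-invariant (hence clopen) and decreasing, so they meet. [cite: MochizukiSemiAnbd2006, Thm. 3.7(iii) p.41] -/
theorem exists_uniform_conj [TopologicalSpace Q] [IsTopologicalGroup Q] [CompactSpace Q]
    {J : Type v} [Preorder J] [IsDirectedOrder J] [Nonempty J] (A : Subgroup Q) (M : J → Subgroup Q)
    (hMn : ∀ j, (M j).Normal) (hMo : ∀ j, IsOpen (M j : Set Q)) (S : J → Subgroup Q) (hS : ∀ j, ∃ γ : Q, S j = A.map (MulAut.conj γ).toMonoidHom ⊔ M j)
    (hSanti : ∀ ⦃i j : J⦄, i ≤ j → S j ≤ S i) :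
    ∃ γ : Q, ∀ j, S j = A.map (MulAut.conj γ).toMonoidHom ⊔ M j := by
  haveI := hMn
  haveI : ∀ j, Finite (Q ⧸ M j) := fun j => Subgroup.quotient_finite_of_isOpen (M j) (hMo j)
  let C : J → Set Q := fun j => {γ | S j = A.map (MulAut.conj γ).toMonoidHom ⊔ M j}
  have hCne : ∀ j, (C j).Nonempty := fun j => hS j
  -- right `M_j`-invariance
  have hCinv : ∀ (j : J) {γ : Q}, γ ∈ C j → ∀ {m : Q}, m ∈ M j → γ * m ∈ C j := by
    intro j γ hγ m hm
    show S j = _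
    rw [map_conj_mul_sup_eq γ hm]; exact hγ
  -- clopen
  have hCopen : ∀ j, IsOpen (C j) := by
    intro j
    rw [isOpen_iff_mem_nhds]
    intro γ hγ
    have hopen : IsOpen ((fun m : Q => γ * m) '' (M j : Set Q)) :=
      (Homeomorph.mulLeft γ).isOpenMap _ (hMo j)
    refine Filter.mem_of_superset (hopen.mem_nhds ⟨1, (M j).one_mem, mul_one γ⟩) ?_
    rintro _ ⟨m, hm, rfl⟩
    exact hCinv j hγ hm
  have hCclosed : ∀ j, IsClosed (C j) := by
    intro j
    rw [← isOpen_compl_iff, isOpen_iff_mem_nhds]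
    intro γ hγ
    have hopen : IsOpen ((fun m : Q => γ * m) '' (M j : Set Q)) :=
      (Homeomorph.mulLeft γ).isOpenMap _ (hMo j)
    refine Filter.mem_of_superset (hopen.mem_nhds ⟨1, (M j).one_mem, mul_one γ⟩) ?_
    rintro _ ⟨m, hm, rfl⟩ hγm
    apply hγ
    have := hCinv j hγm ((M j).inv_mem hm)
    rwa [mul_inv_cancel_right] at this
  -- decreasing
  have hCanti : ∀ ⦃i j : J⦄, i ≤ j → C j ⊆ C i := by
    intro i j hij γ hγ
    obtain ⟨γi, hγi⟩ := hS i
    show S i = _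
    have hle : A.map (MulAut.conj γ).toMonoidHom ≤ A.map (MulAut.conj γi).toMonoidHom ⊔ M i := by
      calc A.map (MulAut.conj γ).toMonoidHom ≤ S j := by rw [show S j = _ from hγ]; exact le_sup_left
        _ ≤ S i := hSanti hij
        _ = _ := hγi
    rw [hγi, ← map_conj_sup_eq_of_le γ γi hle]
  have hCdir : Directed (· ⊇ ·) C := by
    intro i j
    obtain ⟨k, hik, hjk⟩ := exists_ge_ge i j
    exact ⟨k, hCanti hik, hCanti hjk⟩
  obtain ⟨γ, hγ⟩ := IsCompact.nonempty_iInter_of_directed_nonempty_isCompact_isClosed C hCdir hCne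
    (fun j => (hCclosed j).isCompact) hCclosed
  rw [Set.mem_iInter] at hγ
  exact ⟨γ, fun j => hγ j⟩

end Literature.AnabelianGeometry.SemiGraphs
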